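import Summits.QuantumFields.YangMills.Theorems.UnitScaleTiltProp7NumericWindowsInhabitedV3
import HarnessLib

/-!
# Route `UnitScaleTilt`, crux K1 child «MinimiserStabilityRegPr» (stmt-QuantumFields-19200), stub `stub_existenceMinimalOrbit` (EX), route (α) — **«NUMERICS-CENSUS» v5: v4's THIRTY CONJUNCTS WITH THE
# REGULARITY LETTER `α` FORCED BELOW AN ARBITRARY PRESCRIBED POSITIVE THRESHOLD `ecap : ℕ → ℝ`** (new input letter, `0 < ecap L`; new conjunct `hαcap : ∀ L>1, α L ≤ ecap L`).
# WHY (located on the display of record S29ᴸ∕S30ᴸ, by script over its binders): EVERY analytic row of the EX display that is not a pure numeral — `hPos₁ hPosπ hPosΔ norm_G norm_H₁ norm_Hπ h133 h88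
# h349 hCk h137kπ h137kΔ hPcol hC157` — is stated AT the census letter `α` (`RegPr … (α L) U₀ → …` resp. `RegPr … ρ U₀ → ρ ≤ α L → …`) with its constants (`B₀ CH δH CΔ δΔ p139 C349 … CC δC`) as
# free L-only letters; a supplier of such a row in print shape («there are e₀(L) > 0 and constants … such that for every ρ ≤ e₀ …», [Balaban1985BackgroundPropagators] Thm 3.3 p.399, Thm 3.12
# (3.133) p.422) therefore inhabits it only when `α L ≤ e₀ L`.  The census chooses `α` LAST (it reads `B₀` and the column letters), so the final knit needs the census to accept the suppliers'
# thresholds as ONE positive cap `ecap := min of the e₀'s` — this file.  Explicit windows of the form `c·Lᵏ·α ≤ 1` (`hWQ hWε hWε2 hWε''`) remain as conjuncts; any further one is an `ecap` instance.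
# Witnesses: v4's (`ef := (356·10¹⁵·L⁶)⁻¹`, …) with `α := ½·min(v4's min, ecap L)`; proof = v4's with one more `min`.

Cell `ym3-torus`, width seat `ym3-torus-px14` (gen 4).  THEOREMS ONLY (0 `def`, 0 `sorry`); `--supports stmt-QuantumFields-19200 --as helper`; count-neutral.  YM₃ on T³ is a ladder rung (R3),
NOT the Clay problem; nothing here claims the stub, the crux, d = 4 or the mass gap.  PURE REAL ARITHMETIC.

WHAT IS PROVED.  ★★★ `numericWindows_inhabited_family_v5` — for all letters as in v4 and every `ecap > 0`: `∃ ef α a₃ r ε′ εC C₄ M : ℕ → ℝ` with v4's 30 conjuncts VERBATIM IN ORDER plus `hαcap`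
inserted after the C-entry pair, before `hMdoor` (31 conjuncts).  HONEST SCOPE: arithmetic only; nothing about the letters' suppliers.

References: T. Bałaban, CMP **102** (1985) 277–309 [Balaban1985Variational] (Thm 1 p.279, (70)–(77) pp.289–290, Prop. 4 (97)–(98) pp.292–293, (118)–(121) p.295, (136)–(140) pp.298–299);
CMP **99** (1985) 389–434 [Balaban1985BackgroundPropagators] (Thm 3.3 p.399, Thm 3.12 (3.133) p.422).
-/

set_option autoImplicit false

noncomputable section

namespace Summit.QuantumFields.YangMills.Theorems.Prop7NumericWindowsInhabited

set_option maxHeartbeats 400000 in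
/-- ★★★ **«NUMERICS-CENSUS» v5 — v4's THIRTY CONJUNCTS (S16ᴰ∕S17ᴸ numerals + positivity + `hwinC` + `hWe2 hWε2` + the C-entry pair `hWe'' hWε''`) PLUS `hαcap : ∀ L>1, α L ≤ ecap L` FOR AN ARBITRARY
POSITIVE L-ONLY THRESHOLD `ecap`, ARE JOINTLY INHABITED**, for every block size, every `B₀ > 0`, all nonnegative N06 letters `cC c137 kTJ k349 c137π k139π`, column letters `ΘH ΘΔ G` and every
`ecap > 0`.  Witnesses = v4's with `α := ½·min(min(min(min(α₀, ef∕M), min(r∕(2B₀), (10¹⁸L⁵)⁻¹)), a₃), ecap)`; proof = v4's with one more `min`.  USE: the final knit takes `ecap L :=` the minimum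
of the suppliers' regularity thresholds `e₀(L)` of the rows stated at `RegPr … (α L)`.
[cite: Balaban1985Variational, Thm 1 p.279, (70)–(77) pp.289–290, Prop. 4 (97)–(98) pp.292–293, (118)–(121) p.295, (136)–(140) pp.298–299] -/
theorem numericWindows_inhabited_family_v5
    (B₀ cC c137 kTJ k349 c137π k139π ΘH ΘΔ G : ℕ → ℝ) (hB₀ : ∀ L, 1 < L → 0 < B₀ L)
    (hk : ∀ L : ℕ, 1 < L → 0 ≤ cC L ∧ 0 ≤ c137 L ∧ 0 ≤ kTJ L ∧ 0 ≤ k349 L ∧ 0 ≤ c137π L ∧ 0 ≤ k139π L)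
    (hΘH0 : ∀ L, 1 < L → 0 ≤ ΘH L) (hΘΔ0 : ∀ L, 1 < L → 0 ≤ ΘΔ L) (hG0 : ∀ L, 1 < L → 0 ≤ G L)
    (ecap : ℕ → ℝ) (hecap : ∀ L : ℕ, 1 < L → 0 < ecap L) :
    ∃ ef α a₃ r ε' εC C₄ M : ℕ → ℝ,
      (∀ L, 1 < L → 0 < ef L) ∧ (∀ L, 1 < L → 0 < α L) ∧ (∀ L, 1 < L → 0 < a₃ L) ∧ (∀ L, 1 < L → 0 < r L) ∧ (∀ L, 1 < L → 0 < C₄ L) ∧ (∀ L, 1 < L → 0 < M L) ∧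
      -- hWQ hWe hWε hMe hw137
      (∀ L : ℕ, 1 < L → 13 * 10 ^ 14 * (L : ℝ) ^ 3 * α L ≤ 1) ∧ (∀ L : ℕ, 1 < L → 10 ^ 9 * (L : ℝ) ^ 2 * ef L ≤ 1) ∧ (∀ L : ℕ, 1 < L → 10 ^ 12 * (L : ℝ) ^ 3 * α L ≤ 1) ∧
      (∀ L, 1 < L → M L * α L < ef L) ∧ (∀ L : ℕ, 1 < L → 10 ^ 7 * (L : ℝ) ^ 3 * (178 * (α L + ef L)) ≤ 1) ∧
      -- hq47 hR6 hrε2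
      (∀ L : ℕ, 1 < L → 9 * (40 * (2 * (3 * (2 * ef L + 2700 * (L : ℝ) * α L))) / ef L ^ 2) * B₀ L * ε' L < 1) ∧ (∀ L : ℕ, 1 < L → 6 * ε' L ≤ ef L) ∧
      (∀ L : ℕ, 1 < L → 2 * (r L + 2 * B₀ L * α L) ≤ ε' L) ∧
      -- hεC hdomC hselfC hcontrC (regime constant `B₀`, as in S14ᴰ–S16ᴰ)
      (∀ L : ℕ, 1 < L → 0 ≤ εC L) ∧ (∀ L : ℕ, 1 < L → 2 * (εC L + a₃ L) ≤ ef L / 2) ∧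
      (∀ L : ℕ, 1 < L → B₀ L * (40 * (2 * (3 * (2 * ef L + 2700 * (L : ℝ) * α L))) / ef L ^ 2) * (εC L + a₃ L) ^ 2 ≤ εC L) ∧
      (∀ L : ℕ, 1 < L → 4 * B₀ L * (40 * (2 * (3 * (2 * ef L + 2700 * (L : ℝ) * α L))) / ef L ^ 2) * (εC L + a₃ L) < 1) ∧
      -- hrα hr4 hr16
      (∀ L : ℕ, 1 < L → 2 * B₀ L * α L ≤ r L) ∧ (∀ L : ℕ, 1 < L → 4 * r L ≤ a₃ L) ∧ (∀ L : ℕ, 1 < L → 16 * B₀ L * C₄ L * r L ≤ 1) ∧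
      -- hqΘ hR16 hC4
      (∀ L, 1 < L → (εC L + a₃ L) * ΘH L * G L ≤ 1 / 2) ∧
      (∀ L, 1 < L → a₃ L ≤ (1 - 4 * B₀ L * (40 * (2 * (3 * (2 * ef L + 2700 * (L : ℝ) * α L))) / ef L ^ 2) * (εC L + a₃ L)) * (1 / 16)) ∧
      (∀ L, 1 < L → 1 * 2 * ((2 * (1 / (1 - 4 * B₀ L * (40 * (2 * (3 * (2 * ef L + 2700 * (L : ℝ) * α L))) / ef L ^ 2) * (εC L + a₃ L))) + 1) * (ΘH L * G L) / a₃ L) * α L + ((c137π L + k139π L * B₀ L) * (40 * (2 * (3 * (2 * ef L + 2700 * (L : ℝ) * α L))) / ef L ^ 2) * (1 / (1 - 4 * B₀ L * (40 * (2 * (3 * (2 * ef L + 2700 * (L : ℝ) * α L))) / ef L ^ 2) * (εC L + a₃ L))) ^ 2 + 1 * 2 * (2 * ΘΔ L * G L * (1 / (1 - 4 * B₀ L * (40 * (2 * (3 * (2 * ef L + 2700 * (L : ℝ) * α L))) / ef L ^ 2) * (εC L + a₃ L)))))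
            + 1 * 2 * (2 * ΘH L * G L * (1 / (1 - 4 * B₀ L * (40 * (2 * (3 * (2 * ef L + 2700 * (L : ℝ) * α L))) / ef L ^ 2) * (εC L + a₃ L)))) * ((c137π L + k139π L * B₀ L) * (40 * (2 * (3 * (2 * ef L + 2700 * (L : ℝ) * α L))) / ef L ^ 2) * (1 / (1 - 4 * B₀ L * (40 * (2 * (3 * (2 * ef L + 2700 * (L : ℝ) * α L))) / ef L ^ 2) * (εC L + a₃ L))) ^ 2) * a₃ L
            + 1 * 2 * (1 + (2 * ΘH L * G L * (1 / (1 - 4 * B₀ L * (40 * (2 * (3 * (2 * ef L + 2700 * (L : ℝ) * α L))) / ef L ^ 2) * (εC L + a₃ L)))) * a₃ L) * (2 * (1024 * ((3 - 1 : ℕ) : ℝ) * 1 * (α L + 1 / 16) + ((3 - 1 : ℕ) : ℝ) * 138 * 1)) * (1 / (1 - 4 * B₀ L * (40 * (2 * (3 * (2 * ef L + 2700 * (L : ℝ) * α L))) / ef L ^ 2) * (εC L + a₃ L))) ^ 2 ≤ C₄ L) ∧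
      -- hwinC (★px21 ✓p687965, S18∕S19)
      (∀ L, 1 < L → 4 * (40 * (2 * (3 * (2 * ef L + 2700 * (L : ℝ) * α L))) / ef L ^ 2) * B₀ L * ε' L ^ 2 ≤ εC L) ∧
      -- hWe2 hWε2 (★px16 g4 HSPLIT door, S24ᴸ+)
      (∀ L : ℕ, 1 < L → 10 ^ 15 * (L : ℝ) ^ 2 * ef L ≤ 1) ∧ (∀ L : ℕ, 1 < L → 10 ^ 18 * (L : ℝ) ^ 3 * α L ≤ 1) ∧
      -- hWe'' hWε'' (★px18 g3 C-ENTRY `hC157_family` ∕ `hCcol_family`, Route B: `1∕ρ = 10⁷ℓ²`, `1∕R² ≈ 10⁹L²`)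
      (∀ L : ℕ, 1 < L → 10 ^ 11 * (L : ℝ) ^ 6 * ef L ≤ 1) ∧ (∀ L : ℕ, 1 < L → 10 ^ 16 * (L : ℝ) ^ 5 * α L ≤ 1) ∧
      -- hαcap: the regularity letter sits below ANY prescribed positive L-only threshold (the suppliers' `∃ e₀(L)` of the rows stated at `RegPr … (α L)` ∕ `ρ ≤ α L`)
      (∀ L : ℕ, 1 < L → α L ≤ ecap L) ∧
      -- hMdoor
      (∀ L : ℕ, 1 < L → 11 * B₀ L + 4 * B₀ L * (40 * (2 * (3 * (2 * ef L + 2700 * (L : ℝ) * α L))) / ef L ^ 2) * (11 * B₀ L) ^ 2 * α L + ((1 + 25 * C₄ L * B₀ L ^ 2) + cC L * (1 + 25 * C₄ L * B₀ L ^ 2) + c137 L * 2 + kTJ L * (10 * B₀ L) / 2 + 14 * (10 * B₀ L) + k349 L * (10 * B₀ L) / 2 + 2 * (10 * B₀ L)) + 100 * (c137π L + k139π L * B₀ L + k349 L * B₀ L + (28 + 4) * α L * B₀ L) * (40 * (2 * (3 * (2 * ef L + 2700 * (L : ℝ) * α L))) / ef L ^ 2) * B₀ L ^ 2 * α L ≤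 M L) := by
  classical
  -- the witnesses
  let ef : ℕ → ℝ := fun L => 1 / (356 * 10 ^ 15 * (L : ℝ) ^ 6)
  let α₀ : ℕ → ℝ := fun L => ef L / (2700 * (L : ℝ))
  let bH : ℕ → ℝ := fun L => (B₀ L + 1) * (ΘH L * G L + 1) - 1
  let a₃ : ℕ → ℝ := fun L => ef L / (8000 * (bH L + 1))
  obtain ⟨C₄, hC₄eq⟩ : ∃ C₄ : ℕ → ℝ, ∀ L, C₄ L = 1 * 2 * ((2 * (25 / 7) + 1) * (ΘH L * G L))
        + ((c137π L + k139π L * B₀ L) * (720 / ef L) * (25 / 7) ^ 2 + 1 * 2 * (2 * ΘΔ L * G L * (25 / 7)))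
        + 1 * 2 * (2 * ΘH L * G L * (25 / 7)) * ((c137π L + k139π L * B₀ L) * (720 / ef L) * (25 / 7) ^ 2) * a₃ L
        + 1 * 2 * (1 + (2 * ΘH L * G L * (25 / 7)) * a₃ L) * (2 * (1024 * ((3 - 1 : ℕ) : ℝ) * 1 * (1 + 1 / 16) + ((3 - 1 : ℕ) : ℝ) * 138 * 1)) * (25 / 7) ^ 2 + 1 :=
    ⟨_, fun L => rfl⟩
  let r : ℕ → ℝ := fun L => min (a₃ L / 4) (1 / (16 * B₀ L * C₄ L))
  obtain ⟨M, hMeq⟩ : ∃ M : ℕ → ℝ, ∀ L, M L = 11 * B₀ L + 4 * B₀ L * (720 / ef L) * (11 * B₀ L) ^ 2 * α₀ L + ((1 + 25 * C₄ L * B₀ L ^ 2) + cC L * (1 + 25 * C₄ L * B₀ L ^ 2)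
      + c137 L * 2 + kTJ L * (10 * B₀ L) / 2 + 14 * (10 * B₀ L) + k349 L * (10 * B₀ L) / 2 + 2 * (10 * B₀ L))
      + 100 * (c137π L + k139π L * B₀ L + k349 L * B₀ L + (28 + 4) * α₀ L * B₀ L) * (720 / ef L) * B₀ L ^ 2 * α₀ L := ⟨_, fun L => rfl⟩
  let α : ℕ → ℝ := fun L => (1 / 2) * min (min (min (min (α₀ L) (ef L / M L)) (min (r L / (2 * B₀ L)) (1 / (10 ^ 18 * (L : ℝ) ^ 5)))) (a₃ L)) (ecap L)
  let ε' : ℕ → ℝ := fun L => 2 * (r L + 2 * B₀ L * α L)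
  -- positivity of the witnesses and the elementary comparisons, at each `L > 1`
  have hLr : ∀ L : ℕ, 1 < L → (1 : ℝ) ≤ (L : ℝ) := fun L hL => by exact_mod_cast hL.le
  have hef : ∀ L : ℕ, 1 < L → 0 < ef L := fun L hL => by
    have := hLr L hL; simp only [ef]; positivity
  have hx : ∀ L : ℕ, 1 < L → 0 ≤ ΘH L * G L := fun L hL => mul_nonneg (hΘH0 L hL) (hG0 L hL)
  have hbHge : ∀ L : ℕ, 1 < L → B₀ L ≤ bH L := fun L hL => by
    have := hx L hL; have := hB₀ L hL; simp only [bH]; nlinarith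
  have hbH0 : ∀ L : ℕ, 1 < L → 0 < bH L := fun L hL => lt_of_lt_of_le (hB₀ L hL) (hbHge L hL)
  have hbH1 : ∀ L : ℕ, 1 < L → 0 < bH L + 1 := fun L hL => by linarith [hbH0 L hL]
  have ha₃ : ∀ L : ℕ, 1 < L → 0 < a₃ L := fun L hL => by
    have := hef L hL; have := hbH1 L hL; simp only [a₃]; positivity
  have hα₀ : ∀ L : ℕ, 1 < L → 0 < α₀ L := fun L hL => by
    have := hef L hL; have := hLr L hL; simp only [α₀]; positivity
  have hC₄ : ∀ L : ℕ, 1 < L → 0 < C₄ L := fun L hL => by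
    obtain ⟨-, -, -, -, h5, h6⟩ := hk L hL
    have := hef L hL; have := ha₃ L hL; have := hx L hL; have := hΘΔ0 L hL; have := hG0 L hL; have := hΘH0 L hL; have := hB₀ L hL
    rw [hC₄eq]; positivity
  have hr : ∀ L : ℕ, 1 < L → 0 < r L := fun L hL => by
    have := ha₃ L hL; have := hB₀ L hL; have := hC₄ L hL
    simp only [r]; exact lt_min (by positivity) (by positivity)
  have hM : ∀ L : ℕ, 1 < L → 0 < M L := fun L hL => by
    obtain ⟨h1, h2, h3, h4, h5, h6⟩ := hk L hL
    have := hef L hL; have := hB₀ L hL; have := hC₄ L hL; have := hα₀ L hL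
    rw [hMeq]; positivity
  have hα : ∀ L : ℕ, 1 < L → 0 < α L := fun L hL => by
    have := hef L hL; have := hM L hL; have := hr L hL; have := hB₀ L hL; have := hα₀ L hL; have := hLr L hL; have := ha₃ L hL
    simp only [α]
    refine mul_pos (by norm_num) (lt_min (lt_min (lt_min (lt_min ‹0 < α₀ L› (by positivity)) (lt_min (by positivity) (by positivity))) ‹0 < a₃ L›) (hecap L hL))
  -- the five caps on `α`
  have hmin : ∀ L : ℕ, 1 < L → ∀ t : ℝ,
      min (min (min (α₀ L) (ef L / M L)) (min (r L / (2 * B₀ L)) (1 / (10 ^ 18 * (L : ℝ) ^ 5)))) (a₃ L) ≤ t → α L ≤ t / 2 := fun L hL t ht => by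
    have h1 : min (min (min (min (α₀ L) (ef L / M L)) (min (r L / (2 * B₀ L)) (1 / (10 ^ 18 * (L : ℝ) ^ 5)))) (a₃ L)) (ecap L)
        ≤ min (min (min (α₀ L) (ef L / M L)) (min (r L / (2 * B₀ L)) (1 / (10 ^ 18 * (L : ℝ) ^ 5)))) (a₃ L) := min_le_left _ _
    simp only [α]; linarith
  have hα_lecap : ∀ L : ℕ, 1 < L → α L ≤ ecap L / 2 := fun L hL => by
    have h1 : min (min (min (min (α₀ L) (ef L / M L)) (min (r L / (2 * B₀ L)) (1 / (10 ^ 18 * (L : ℝ) ^ 5)))) (a₃ L)) (ecap L) ≤ ecap L :=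
      min_le_right _ _
    simp only [α]; linarith
  have hα_le₀ : ∀ L : ℕ, 1 < L → α L ≤ α₀ L / 2 := fun L hL =>
    hmin L hL _ (((min_le_left _ _).trans (min_le_left _ _)).trans (min_le_left _ _))
  have hα_leM : ∀ L : ℕ, 1 < L → α L ≤ (ef L / M L) / 2 := fun L hL =>
    hmin L hL _ (((min_le_left _ _).trans (min_le_left _ _)).trans (min_le_right _ _))
  have hα_ler : ∀ L : ℕ, 1 < L → α L ≤ (r L / (2 * B₀ L)) / 2 := fun L hL =>
    hmin L hL _ (((min_le_left _ _).trans (min_le_right _ _)).trans (min_le_left _ _))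
  have hα_leQ : ∀ L : ℕ, 1 < L → α L ≤ (1 / (10 ^ 18 * (L : ℝ) ^ 5)) / 2 := fun L hL =>
    hmin L hL _ (((min_le_left _ _).trans (min_le_right _ _)).trans (min_le_right _ _))
  have hα_lea : ∀ L : ℕ, 1 < L → α L ≤ a₃ L / 2 := fun L hL => hmin L hL _ (min_le_right _ _)
  -- derived comparisons
  have hα_le_α₀ : ∀ L : ℕ, 1 < L → α L ≤ α₀ L := fun L hL => by linarith [hα_le₀ L hL, hα₀ L hL]
  have hα_le_a₃ : ∀ L : ℕ, 1 < L → α L ≤ a₃ L := fun L hL => by linarith [hα_lea L hL, ha₃ L hL]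
  have h2700 : ∀ L : ℕ, 1 < L → 2700 * (L : ℝ) * α L ≤ ef L := fun L hL => by
    have hL0 : (0 : ℝ) < L := by linarith [hLr L hL]
    have h := hα_le_α₀ L hL
    simp only [α₀] at h
    rw [le_div_iff₀ (by positivity)] at h
    linarith
  have hC₂ : ∀ L : ℕ, 1 < L → 40 * (2 * (3 * (2 * ef L + 2700 * (L : ℝ) * α L))) / ef L ^ 2 ≤ 720 / ef L := fun L hL =>
    C₂_le (hef L hL) (h2700 L hL)
  have hC₂0 : ∀ L : ℕ, 1 < L → 0 ≤ 40 * (2 * (3 * (2 * ef L + 2700 * (L : ℝ) * α L))) / ef L ^ 2 := fun L hL =>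
    C₂_nonneg (hef L hL) (by linarith [hLr L hL]) (hα L hL).le
  have hα_le_ef : ∀ L : ℕ, 1 < L → α L ≤ ef L := fun L hL => by
    have h := h2700 L hL
    have hL1 := hLr L hL
    nlinarith [hα L hL]
  have hef_le_one : ∀ L : ℕ, 1 < L → ef L ≤ 1 := fun L hL => by
    have hL1 := hLr L hL
    have hL0 : (0 : ℝ) < L := by linarith
    simp only [ef]
    rw [div_le_one (by positivity)]
    nlinarith [one_le_pow₀ (n := 6) hL1]
  have hef_le_7400 : ∀ L : ℕ, 1 < L → ef L ≤ 7 / 400 := fun L hL => by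
    have hL1 := hLr L hL
    have hL0 : (0 : ℝ) < L := by linarith
    simp only [ef]
    rw [div_le_div_iff₀ (by positivity) (by norm_num)]
    nlinarith [one_le_pow₀ (n := 6) hL1]
  -- the two generic absolute-window engines: `c·Lᵏ·ef ≤ 1` whenever `c ≤ 356·10¹⁵` and `k ≤ 6`; `c·Lᵏ·α ≤ 1` whenever `c ≤ 2·10¹⁸` and `k ≤ 5`
  have hE : ∀ L : ℕ, 1 < L → ∀ (c : ℝ) (k : ℕ), 0 ≤ c → c ≤ 356 * 10 ^ 15 → k ≤ 6 → c * (L : ℝ) ^ k * ef L ≤ 1 := fun L hL c k hc0 hc hk => by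
    have hL1 := hLr L hL
    have hL0 : (0 : ℝ) < L := by linarith
    have hpow : (L : ℝ) ^ k ≤ (L : ℝ) ^ 6 := pow_le_pow_right₀ hL1 hk
    have h6 : (0 : ℝ) < (L : ℝ) ^ 6 := by positivity
    calc c * (L : ℝ) ^ k * ef L ≤ (356 * 10 ^ 15) * (L : ℝ) ^ 6 * ef L := by
            have := (hef L hL).le; gcongr
      _ = 1 := by
            have hX : (356 * 10 ^ 15 * (L : ℝ) ^ 6 : ℝ) ≠ 0 := by positivity
            simp only [ef]; rw [one_div, mul_inv_cancel₀ hX]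
  have hQ : ∀ L : ℕ, 1 < L → ∀ (c : ℝ) (k : ℕ), 0 ≤ c → c ≤ 2 * 10 ^ 18 → k ≤ 5 → c * (L : ℝ) ^ k * α L ≤ 1 := fun L hL c k hc0 hc hk => by
    have hL1 := hLr L hL
    have hL0 : (0 : ℝ) < L := by linarith
    have hpow : (L : ℝ) ^ k ≤ (L : ℝ) ^ 5 := pow_le_pow_right₀ hL1 hk
    have h5 : (0 : ℝ) < (L : ℝ) ^ 5 := by positivity
    have h := hα_leQ L hL
    rw [div_div, le_div_iff₀ (by positivity)] at h
    calc c * (L : ℝ) ^ k * α L ≤ (2 * 10 ^ 18) * (L : ℝ) ^ 5 * α L := by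
            have := (hα L hL).le; gcongr
      _ = α L * (10 ^ 18 * (L : ℝ) ^ 5 * 2) := by ring
      _ ≤ 1 := h
  have hα_le_one : ∀ L : ℕ, 1 < L → α L ≤ 1 := fun L hL => (hα_le_ef L hL).trans (hef_le_one L hL)
  have hr_le_a₃ : ∀ L : ℕ, 1 < L → r L ≤ a₃ L / 4 := fun L hL => min_le_left _ _
  have hr_le_C₄ : ∀ L : ℕ, 1 < L → r L ≤ 1 / (16 * B₀ L * C₄ L) := fun L hL => min_le_right _ _
  have h2B₀α : ∀ L : ℕ, 1 < L → 2 * B₀ L * α L ≤ r L / 2 := fun L hL => by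
    have h := hα_ler L hL
    have hB := hB₀ L hL
    rw [div_div, le_div_iff₀ (by positivity)] at h
    linarith
  have hε'_le : ∀ L : ℕ, 1 < L → ε' L ≤ a₃ L := fun L hL => by
    simp only [ε']; linarith [h2B₀α L hL, hr_le_a₃ L hL, (ha₃ L hL).le]
  have hε'0 : ∀ L : ℕ, 1 < L → 0 ≤ ε' L := fun L hL => by
    have := hr L hL; have := hB₀ L hL; have := hα L hL; simp only [ε']; positivity
  have ha₃def : ∀ L : ℕ, a₃ L = ef L / (8000 * (bH L + 1)) := fun L => rfl
  -- the B₀-rows from the bH′-rows by monotonicity (`B₀ ≤ bH′`)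
  have hself : ∀ L : ℕ, 1 < L → B₀ L * (40 * (2 * (3 * (2 * ef L + 2700 * (L : ℝ) * α L))) / ef L ^ 2) * (a₃ L + a₃ L) ^ 2 ≤ a₃ L := fun L hL => by
    have h := row_hselfC (hef L hL) (hbH0 L hL) (hC₂ L hL) (ha₃def L)
    have hB := hB₀ L hL; have hC := hC₂0 L hL
    calc B₀ L * (40 * (2 * (3 * (2 * ef L + 2700 * (L : ℝ) * α L))) / ef L ^ 2) * (a₃ L + a₃ L) ^ 2
        ≤ bH L * (40 * (2 * (3 * (2 * ef L + 2700 * (L : ℝ) * α L))) / ef L ^ 2) * (a₃ L + a₃ L) ^ 2 := by gcongr; exact hbHge L hL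
      _ ≤ a₃ L := h
  have hcontr : ∀ L : ℕ, 1 < L → 4 * B₀ L * (40 * (2 * (3 * (2 * ef L + 2700 * (L : ℝ) * α L))) / ef L ^ 2) * (a₃ L + a₃ L) < 1 := fun L hL => by
    have h := row_hcontrC (hef L hL) (hbH0 L hL) (hC₂ L hL) (ha₃def L)
    have hB := hB₀ L hL; have hC := hC₂0 L hL; have ha := ha₃ L hL
    calc 4 * B₀ L * (40 * (2 * (3 * (2 * ef L + 2700 * (L : ℝ) * α L))) / ef L ^ 2) * (a₃ L + a₃ L)
        ≤ 4 * bH L * (40 * (2 * (3 * (2 * ef L + 2700 * (L : ℝ) * α L))) / ef L ^ 2) * (a₃ L + a₃ L) := by gcongr; exact hbHge L hL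
      _ < 1 := h
  refine ⟨ef, α, a₃, r, ε', a₃, C₄, M, hef, hα, ha₃, hr, hC₄, hM, ?_, ?_, ?_, ?_, ?_, ?_, ?_, ?_, ?_, ?_, ?_, ?_, ?_, ?_, ?_, ?_, ?_, ?_, ?_, ?_, ?_, ?_, ?_, ?_, ?_⟩
  -- hWQ
  · intro L hL
    linarith [hQ L hL (13 * 10 ^ 14) 3 (by norm_num) (by norm_num) (by norm_num)]
  -- hWe
  · intro L hL
    linarith [hE L hL (10 ^ 9) 2 (by norm_num) (by norm_num) (by norm_num)]
  -- hWε
  · intro L hL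
    linarith [hQ L hL (10 ^ 12) 3 (by norm_num) (by norm_num) (by norm_num)]
  -- hMe
  · intro L hL
    have h := hα_leM L hL
    have hM' := hM L hL
    rw [div_div, le_div_iff₀ (by positivity)] at h
    nlinarith [hef L hL]
  -- hw137
  · intro L hL
    have hL0 : (0 : ℝ) < L := by linarith [hLr L hL]
    have hαe := hα_le_ef L hL
    have key : 10 ^ 7 * (L : ℝ) ^ 3 * (178 * (2 * ef L)) ≤ 1 := by
      have h := hE L hL (356 * 10 ^ 7) 3 (by norm_num) (by norm_num) (by norm_num)
      linarith
    nlinarith [pow_pos hL0 3]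
  -- hq47 (at the regime letter bH′ ≥ B₀)
  · intro L hL
    exact row_hq47 (hef L hL) (hB₀ L hL) (hbHge L hL) (hC₂ L hL) (hε'0 L hL) (hε'_le L hL) (ha₃def L)
  -- hR6
  · intro L hL
    exact row_hR6 (hef L hL) (hbH0 L hL) (hε'_le L hL) (ha₃def L)
  -- hrε2
  · intro L hL
    exact le_rfl
  -- hεC
  · intro L hL
    exact (ha₃ L hL).le
  -- hdomC
  · intro L hL
    exact row_hdomC (hef L hL) (hbH0 L hL) (ha₃def L)
  -- hselfC
  · intro L hL
    exact hself L hL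
  -- hcontrC
  · intro L hL
    exact hcontr L hL
  -- hrα
  · intro L hL
    linarith [h2B₀α L hL, hr L hL]
  -- hr4
  · intro L hL
    linarith [hr_le_a₃ L hL]
  -- hr16
  · intro L hL
    have h := hr_le_C₄ L hL
    have := hB₀ L hL; have := hC₄ L hL
    rw [le_div_iff₀ (by positivity)] at h
    linarith
  -- hqΘ
  · intro L hL
    exact row_hqΘ (hef L hL) (hef_le_one L hL) (hB₀ L hL) (hΘH0 L hL) (hG0 L hL) (rfl : a₃ L = ef L / (8000 * (((B₀ L + 1) * (ΘH L * G L + 1) - 1) + 1)))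
  -- hR16
  · intro L hL
    have h := row_hR16_le (hef L hL) (hef_le_7400 L hL) (hbH0 L hL) (hC₂ L hL) (ha₃def L)
    -- `(1 − 4bH′C₂(2a₃))∕16 ≤ (1 − 4B₀C₂(2a₃))∕16`
    have hmono : (1 - 4 * bH L * (40 * (2 * (3 * (2 * ef L + 2700 * (L : ℝ) * α L))) / ef L ^ 2) * (a₃ L + a₃ L)) * (1 / 16)
        ≤ (1 - 4 * B₀ L * (40 * (2 * (3 * (2 * ef L + 2700 * (L : ℝ) * α L))) / ef L ^ 2) * (a₃ L + a₃ L)) * (1 / 16) := by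
      have hC := hC₂0 L hL; have ha := (ha₃ L hL).le; have hb := hbHge L hL
      have h4 : 4 * B₀ L * (40 * (2 * (3 * (2 * ef L + 2700 * (L : ℝ) * α L))) / ef L ^ 2) * (a₃ L + a₃ L)
          ≤ 4 * bH L * (40 * (2 * (3 * (2 * ef L + 2700 * (L : ℝ) * α L))) / ef L ^ 2) * (a₃ L + a₃ L) := by
        have hB := (hB₀ L hL).le; gcongr
      exact mul_le_mul_of_nonneg_right (sub_le_sub_left h4 1) (by norm_num)
    exact h.trans hmono
  -- hC4
  · intro L hL
    obtain ⟨-, -, -, -, h5, h6⟩ := hk L hL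
    have hN₁ : 0 ≤ c137π L + k139π L * B₀ L := by have := hB₀ L hL; positivity
    have h := row_hC4_S16 (hef L hL) (hB₀ L hL) (hbHge L hL) (hC₂0 L hL) (hC₂ L hL) (ha₃def L) (hα L hL).le (hα_le_one L hL) (hα_le_a₃ L hL)
      (hΘH0 L hL) (hΘΔ0 L hL) (hG0 L hL) hN₁
    rw [hC₄eq]
    exact h.trans (le_add_of_nonneg_right zero_le_one)
  -- hwinC
  · intro L hL
    exact row_hwinC (hε'0 L hL) (hε'_le L hL)
      (row_hq47 (hef L hL) (hB₀ L hL) (hbHge L hL) (hC₂ L hL) (hε'0 L hL) (hε'_le L hL) (ha₃def L))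
  -- hWe2
  · intro L hL
    linarith [hE L hL (10 ^ 15) 2 (by norm_num) (by norm_num) (by norm_num)]
  -- hWε2
  · intro L hL
    linarith [hQ L hL (10 ^ 18) 3 (by norm_num) (by norm_num) (by norm_num)]
  -- hWe''
  · intro L hL
    linarith [hE L hL (10 ^ 11) 6 (by norm_num) (by norm_num) (by norm_num)]
  -- hWε''
  · intro L hL
    linarith [hQ L hL (10 ^ 16) 5 (by norm_num) (by norm_num) (by norm_num)]
  -- hαcap
  · intro L hL
    linarith [hα_lecap L hL, hecap L hL]
  -- hMdoor
  · intro L hL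
    obtain ⟨-, -, -, h4, h5, h6⟩ := hk L hL
    rw [hMeq]
    exact row_hMdoor (hef L hL) (hB₀ L hL) (hα L hL).le (hα_le_α₀ L hL) (hC₂0 L hL) (hC₂ L hL) h4 h5 h6

end Summit.QuantumFields.YangMills.Theorems.Prop7NumericWindowsInhabited

end
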